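import Summits.ResolutionOfSingularities.ResolutionOfSingularities.Theorems.FrobeniusClosingSteerDescentSpaceShear
import Mathlib.Algebra.CharP.Two
import Mathlib.Algebra.MvPolynomial.CommRing
import HarnessLib

/-!
# Descent space, file 5 (W4.1, F-B card 7): L2c — EVEN PERSISTENCE confines the near point to the descent space

W4.1, crux `Steer` (stmt-ResolutionOfSingularities-16345), frontier piece F-B; the last polynomial core of res-L0-w41-idea-1's
card 7 `kangaroo-free-parity-automaton` (`Sketch-idea-1-v9-fb.lean` 1cd28c90a6f7445c, `stub_mem_descentSpace_of_even_persistence`;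
res-L0-w41-plan-1 RULINGS 81b/84d; idea-1 g8 «citable: yes»). Over files 1–4 (seat res-D-pv-007 AS res-L0-w41-stub-5):

* §7 homogenisation in the chart `X_j ≠ 0`, all as explicit `aeval`s (no definitions): the dehomogenisation `X_j ↦ 1` on monomials
  (`aeval_dehom_monomial`), **a form is determined by its dehomogenisation** (`eq_of_isHomogeneous_of_aeval_dehom_eq`),
  `dehomTransl ∘ dehomTransl = (X_j ↦ 1)` in characteristic `2` (`dehomTransl_dehomTransl`), `(X_j ↦ 1) ∘ η_c = dehomTransl`
  for the re-homogenising substitution `η_c : X_i ↦ X_i + c_i X_j` (`aeval_dehom_eta`), `η_c` preserves forms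
  (`isHomogeneous_aeval_eta`), `dehomTransl` kills `X_j` and does not raise degrees, and `η_c R` is invariant along `c` for
  `X_j`-free `R` when `c_j = 1` (`isLineInvariant_aeval_eta`);
* **`mem_descentSpace_of_even_persistence`** (the sketch's L2c, PROVED, general `σ`; `…_fin4` = literally as typed): `Φ` a form of
  degree `2d` over a perfect field of characteristic `2`, `c_j = 1`, `dehomTransl_j^c Φ ≡ q²` modulo degree `≥ 2d` ⇒ `c ∈ W(Φ)`.

With files 1–4 this closes ALL SIX stubs of the sketch in the kernel. OURS (research support for an idea card; candidates, not
facts); nothing here is a statement of the manuscript under review [claim: Hironaka2017, status: under-review]; AI work, weaker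
than expert review. [cite: Hauser2010, §F] [folklore]
-/

noncomputable section

-- `Summit.<S>.<S>.…` duplicates the summit name by design (single-problem summit).
set_option linter.dupNamespace false

open MvPolynomial

namespace Summit.ResolutionOfSingularities.ResolutionOfSingularities.Theorems.SwitchingDichotomy.DescentSpace

universe u v

/-! ## §7 Even persistence (L2c): homogenisation in the chart `X_j ≠ 0` -/

section Persistence

variable {κ : Type u} [Field κ] {σ : Type v} [DecidableEq σ]

omit [DecidableEq σ] in
/-- Homogeneity in terms of the support: every monomial has total degree `n`. [folklore] -/
theorem isHomogeneous_iff_forall_mem_support (P : MvPolynomial σ κ) (n : ℕ) :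
    P.IsHomogeneous n ↔ ∀ m ∈ P.support, (m.sum fun _ e => e) = n := by
  have hw : ∀ m : σ →₀ ℕ, Finsupp.weight (1 : σ → ℕ) m = m.sum fun _ e => e := fun m => by
    simp [Finsupp.weight_apply]
  constructor
  · intro h m hm
    rw [← hw]; exact h (mem_support_iff.mp hm)
  · intro h m hm
    rw [hw]; exact h m (mem_support_iff.mpr hm)

/-- The dehomogenisation `X_j ↦ 1` on a monomial erases the `j`-th exponent. [folklore] -/
theorem aeval_dehom_monomial (j : σ) (m : σ →₀ ℕ) (a : κ) :
    aeval (fun i => if i = j then (1 : MvPolynomial σ κ) else X i) (monomial m a) = monomial (m.erase j) a := by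
  rw [aeval_monomial, MvPolynomial.algebraMap_eq, monomial_eq]
  congr 1
  conv_lhs => rw [← Finsupp.erase_add_single j m]
  rw [Finsupp.prod_add_index' (h := fun i k => (if i = j then (1 : MvPolynomial σ κ) else X i) ^ k)
    (fun _ => pow_zero _) (fun _ _ _ => pow_add _ _ _),
    Finsupp.prod_single_index (h := fun i k => (if i = j then (1 : MvPolynomial σ κ) else X i) ^ k) (pow_zero _),
    if_pos rfl, one_pow, mul_one]
  refine Finsupp.prod_congr fun i hi => ?_
  have hij : i ≠ j := by
    rintro rfl; simp at hi
  rw [if_neg hij]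

omit [DecidableEq σ] in
/-- Two monomials of the same degree with the same exponents off `j` are equal. [folklore] -/
theorem eq_of_erase_eq_of_sum_eq (j : σ) {m m' : σ →₀ ℕ} (h : m.erase j = m'.erase j)
    (hd : (m.sum fun _ e => e) = m'.sum fun _ e => e) : m = m' := by
  have hdeg : ∀ f : σ →₀ ℕ, (f.sum fun _ e => e) = Finsupp.degree f := fun f => rfl
  rw [hdeg, hdeg] at hd
  have h1 := Finsupp.erase_add_single j m
  have h2 := Finsupp.erase_add_single j m'
  have hj : m j = m' j := by
    have e1 := congrArg Finsupp.degree h1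
    have e2 := congrArg Finsupp.degree h2
    rw [map_add, Finsupp.degree_single] at e1 e2
    rw [h] at e1
    omega
  rw [← h1, ← h2, h, hj]

/-- **A form is determined by its dehomogenisation**: two homogeneous polynomials of the same degree with the same image
under `X_j ↦ 1` are equal (the coefficient of `X^m`, `|m| = n`, is the coefficient of `X^(m − m_j e_j)` downstairs).
[folklore] -/
theorem eq_of_isHomogeneous_of_aeval_dehom_eq (j : σ) {n : ℕ} {P P' : MvPolynomial σ κ} (hP : P.IsHomogeneous n)
    (hP' : P'.IsHomogeneous n)
    (h : aeval (fun i => if i = j then (1 : MvPolynomial σ κ) else X i) P =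
      aeval (fun i => if i = j then (1 : MvPolynomial σ κ) else X i) P') : P = P' := by
  -- coefficient formula downstairs
  have key : ∀ {R : MvPolynomial σ κ}, R.IsHomogeneous n → ∀ m : σ →₀ ℕ, (m.sum fun _ e => e) = n →
      coeff (m.erase j) (aeval (fun i => if i = j then (1 : MvPolynomial σ κ) else X i) R) = coeff m R := by
    intro R hR m hm
    conv_lhs => rw [R.as_sum, map_sum]
    simp only [aeval_dehom_monomial, coeff_sum, coeff_monomial]
    rw [(isHomogeneous_iff_forall_mem_support R n).mp hR |> fun hR' => Finset.sum_congr rfl fun m' hm' =>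
      show (if m'.erase j = m.erase j then coeff m' R else 0) = if m' = m then coeff m' R else 0 by
        by_cases hmm : m' = m
        · rw [if_pos hmm, if_pos (by rw [hmm])]
        · rw [if_neg hmm, if_neg fun he => hmm (eq_of_erase_eq_of_sum_eq j he ((hR' m' hm').trans hm.symm))]]
    rw [Finset.sum_ite_eq']
    by_cases hms : m ∈ R.support
    · rw [if_pos hms]
    · rw [if_neg hms, notMem_support_iff.mp hms]
  ext m
  by_cases hm : (m.sum fun _ e => e) = n
  · rw [← key hP m hm, ← key hP' m hm, h]
  · have hw : Finsupp.weight (1 : σ → ℕ) m ≠ n := by simpa [Finsupp.weight_apply] using hm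
    rw [hP.coeff_eq_zero (by rwa [Finsupp.degree_eq_weight_one]), hP'.coeff_eq_zero
      (by rwa [Finsupp.degree_eq_weight_one])]

/-- In characteristic `2`, `dehomTransl_j^c ∘ dehomTransl_j^c = (X_j ↦ 1)` (`(X_i + c_i) + c_i = X_i`). [folklore] -/
theorem dehomTransl_dehomTransl [CharP κ 2] (j : σ) (c : σ → κ) (P : MvPolynomial σ κ) :
    dehomTransl κ j c (dehomTransl κ j c P) = aeval (fun i => if i = j then (1 : MvPolynomial σ κ) else X i) P := by
  unfold dehomTransl
  induction P using MvPolynomial.induction_on with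
  | C a => rw [aeval_C, MvPolynomial.algebraMap_eq, aeval_C, MvPolynomial.algebraMap_eq, aeval_C,
      MvPolynomial.algebraMap_eq]
  | add p q hp hq => rw [map_add, map_add, hp, hq, map_add]
  | mul_X p i hp =>
    rw [map_mul, map_mul, hp, map_mul, aeval_X, aeval_X]
    congr 1
    by_cases hi : i = j
    · subst hi; rw [if_pos rfl, if_pos rfl, map_one]
    · rw [if_neg hi, if_neg hi, map_add, aeval_X, aeval_C, MvPolynomial.algebraMap_eq, if_neg hi, add_assoc,
        CharTwo.add_self_eq_zero, add_zero]

/-- `(X_j ↦ 1) ∘ η_c = dehomTransl_j^c` for the substitution `η_c : X_i ↦ X_i + c_i X_j` (`i ≠ j`), `X_j ↦ X_j`. [folklore] -/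
theorem aeval_dehom_eta (j : σ) (c : σ → κ) (P : MvPolynomial σ κ) :
    aeval (fun i => if i = j then (1 : MvPolynomial σ κ) else X i)
      (aeval (fun i => if i = j then X j else X i + C (c i) * X j) P) = dehomTransl κ j c P := by
  unfold dehomTransl
  induction P using MvPolynomial.induction_on with
  | C a => rw [aeval_C, MvPolynomial.algebraMap_eq, aeval_C, MvPolynomial.algebraMap_eq, aeval_C,
      MvPolynomial.algebraMap_eq]
  | add p q hp hq => rw [map_add, map_add, hp, hq, map_add]
  | mul_X p i hp =>
    rw [map_mul, map_mul, hp, map_mul, aeval_X, aeval_X]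
    congr 1
    by_cases hi : i = j
    · subst hi; rw [if_pos rfl, if_pos rfl, aeval_X, if_pos rfl]
    · rw [if_neg hi, if_neg hi, map_add, map_mul, aeval_X, aeval_X, aeval_C, MvPolynomial.algebraMap_eq,
        if_neg hi, if_pos rfl, mul_one]

/-- The substitution `η_c` preserves homogeneity (its values on variables are linear forms). [folklore] -/
theorem isHomogeneous_aeval_eta (j : σ) (c : σ → κ) {P : MvPolynomial σ κ} {n : ℕ} (hP : P.IsHomogeneous n) :
    (aeval (fun i => if i = j then X j else X i + C (c i) * X j) P).IsHomogeneous n := by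
  rw [P.as_sum, map_sum]
  refine IsHomogeneous.sum _ _ _ fun m hm => ?_
  rw [aeval_monomial, MvPolynomial.algebraMap_eq, Finsupp.prod]
  have hdeg : n = ∑ i ∈ m.support, m i := hP.degree_eq_sum_deg_support hm
  rw [hdeg]
  have h1 : ∀ i, ((if i = j then X j else X i + C (c i) * X j : MvPolynomial σ κ)).IsHomogeneous 1 := by
    intro i
    by_cases hi : i = j
    · rw [if_pos hi]; exact isHomogeneous_X κ j
    · rw [if_neg hi]
      exact (isHomogeneous_X κ i).add ((isHomogeneous_X κ j).C_mul (c i))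
  have hprod := IsHomogeneous.prod m.support (fun i => (if i = j then X j else X i + C (c i) * X j) ^ m i)
    (fun i => m i) fun i _ => by simpa using (h1 i).pow (m i)
  exact hprod.C_mul _

/-- `dehomTransl` kills `X_j`: no monomial of `dehomTransl_j^c P` involves `X_j`. [folklore] -/
theorem dehomTransl_support_free (j : σ) (c : σ → κ) (P : MvPolynomial σ κ) :
    ∀ m ∈ (dehomTransl κ j c P).support, m j = 0 := by
  intro m hm
  by_contra hmj
  have hj : j ∈ (bind₁ (fun i => if i = j then (1 : MvPolynomial σ κ) else X i + C (c i)) P).vars := by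
    rw [← aeval_eq_bind₁]
    exact (mem_vars_iff_mem_support j).mpr ⟨m, hm, Finsupp.mem_support_iff.mpr hmj⟩
  obtain ⟨i, -, hi⟩ := mem_vars_bind₁ _ P hj
  by_cases hij : i = j
  · subst hij; simp at hi
  · rw [if_neg hij] at hi
    have := vars_add_subset _ _ hi
    rw [vars_X, vars_C, Finset.union_empty, Finset.mem_singleton] at this
    exact hij this.symm

/-- `dehomTransl` does not raise the total degree (it substitutes polynomials of degree `≤ 1`). [folklore] -/
theorem sum_le_of_mem_support_dehomTransl (j : σ) (c : σ → κ) (P : MvPolynomial σ κ) {m : σ →₀ ℕ}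
    (hm : m ∈ (dehomTransl κ j c P).support) : (m.sum fun _ e => e) ≤ P.totalDegree := by
  refine (le_totalDegree hm).trans ?_
  unfold dehomTransl
  conv_lhs => rw [P.as_sum, map_sum]
  refine (totalDegree_finsetSum _ _).trans (Finset.sup_le fun m' hm' => ?_)
  rw [aeval_monomial, MvPolynomial.algebraMap_eq, Finsupp.prod]
  refine (totalDegree_mul _ _).trans ?_
  rw [totalDegree_C, zero_add]
  refine (totalDegree_finsetProd _ _).trans ?_
  refine le_trans (Finset.sum_le_sum fun i _ => (totalDegree_pow _ _).trans
    (Nat.mul_le_mul_left (m' i) (show totalDegree (if i = j then (1 : MvPolynomial σ κ) else X i + C (c i)) ≤ 1 from ?_)))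
    ?_
  · by_cases hi : i = j
    · rw [if_pos hi, totalDegree_one]; exact zero_le_one
    · rw [if_neg hi]
      refine (totalDegree_add _ _).trans (max_le ?_ ?_)
      · rw [totalDegree_X]
      · rw [totalDegree_C]; exact zero_le_one
  · simp only [mul_one]
    exact le_totalDegree hm'

/-- In characteristic `2`, `η_c R` is invariant along `c` when `R` is free of `X_j` and `c_j = 1`
(`X_i + c_i X_j ↦ (X_i + c_i t) + c_i (X_j + t) = X_i + c_i X_j`). [folklore] -/
theorem isLineInvariant_aeval_eta [CharP κ 2] {j : σ} {c : σ → κ} (hc : c j = 1) (R : MvPolynomial σ κ)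
    (hR : ∀ m ∈ R.support, m j = 0) :
    IsLineInvariant κ c (aeval (fun i => if i = j then X j else X i + C (c i) * X j) R) := by
  unfold IsLineInvariant
  -- generator identity, off `j`
  have hgen : ∀ i, i ≠ j → genTransl κ c ((if i = j then X j else X i + C (c i) * X j : MvPolynomial σ κ)) =
      map (algebraMap κ (Polynomial κ)) (if i = j then X j else X i + C (c i) * X j) := by
    intro i hi
    rw [if_neg hi]
    simp only [map_add, map_mul, genTransl_X, genTransl_C, map_X, map_C, Polynomial.algebraMap_eq, hc, map_one,
      one_mul]
    have h2 := CharTwo.add_self_eq_zero (C (Polynomial.C (c i)) * C Polynomial.X : MvPolynomial σ (Polynomial κ))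
    linear_combination h2
  conv_lhs => rw [R.as_sum, map_sum, map_sum]
  conv_rhs => rw [R.as_sum, map_sum, map_sum]
  refine Finset.sum_congr rfl fun m hm => ?_
  rw [aeval_monomial, MvPolynomial.algebraMap_eq, map_mul, map_mul,
    show genTransl κ c (C (coeff m R)) = map (algebraMap κ (Polynomial κ)) (C (coeff m R)) from isLineInvariant_C c _,
    Finsupp.prod, map_prod, map_prod]
  congr 1
  refine Finset.prod_congr rfl fun i hi => ?_
  have hij : i ≠ j := by
    rintro rfl; exact (Finsupp.mem_support_iff.mp hi) (hR m hm)
  rw [map_pow, map_pow, hgen i hij]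

/-- **L2c — EVEN PERSISTENCE CONFINES TO THE DESCENT SPACE** (res-L0-w41-idea-1 card 7
`stub_mem_descentSpace_of_even_persistence`, PROVED): if `Φ` is a form of even degree `2d` over a perfect field of
characteristic `2` and at the point `c` of the chart `U_j` (`c_j = 1`) the dehomogenised translate `φ_c = dehomTransl_j^c Φ`
is a square modulo monomials of degree `≥ 2d`, then `c ∈ W(Φ)`. Proof: truncate the square root to the `X_j`-free monomials
of degree `≤ d` (`q₁`); then `R₁ := φ_c − q₁²` is an `X_j`-free FORM of degree `2d`; homogenise `q₁` to a form `H` of degree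
`d` and put `Q := η_c H`; the forms `Φ + Q²` and `η_c R₁` of degree `2d` have the same dehomogenisation
(`dehomTransl ∘ dehomTransl = (X_j ↦ 1)` in characteristic `2`), hence coincide, and `η_c R₁` is invariant along `c`; conclude
by L2b. [folklore] -/
theorem mem_descentSpace_of_even_persistence [CharP κ 2] [PerfectField κ] [Fintype σ] (d : ℕ) (j : σ)
    (Φ : MvPolynomial σ κ) (hΦ : Φ.IsHomogeneous (2 * d)) (c : σ → κ) (hc : c j = 1)
    (h : SubTopIsSquare κ (2 * d) (dehomTransl κ j c Φ)) : c ∈ descentSpace κ Φ := by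
  obtain ⟨q, hq⟩ := h
  have hφj : ∀ m ∈ (dehomTransl κ j c Φ).support, m j = 0 := dehomTransl_support_free j c Φ
  have hφdeg : ∀ m ∈ (dehomTransl κ j c Φ).support, (m.sum fun _ e => e) ≤ 2 * d := fun m hm =>
    (sum_le_of_mem_support_dehomTransl j c Φ hm).trans hΦ.totalDegree_le
  -- the `X_j`-free part of `q` of degree `≤ d`, and the rest
  set q₁ : MvPolynomial σ κ := ∑ m ∈ q.support.filter (fun m => m j = 0 ∧ (m.sum fun _ e => e) ≤ d),
    monomial m (coeff m q) with hq₁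
  set qr : MvPolynomial σ κ := ∑ m ∈ q.support.filter (fun m => ¬ (m j = 0 ∧ (m.sum fun _ e => e) ≤ d)),
    monomial m (coeff m q) with hqr
  have hsplit : q = q₁ + qr := by
    rw [hq₁, hqr, Finset.sum_filter_add_sum_filter_not]; exact q.as_sum
  have hq₁supp : ∀ m ∈ q₁.support, m j = 0 ∧ (m.sum fun _ e => e) ≤ d := fun m hm => by
    rw [mem_support_iff, hq₁, coeff_sum_filter_monomial] at hm
    by_contra h'; exact hm (if_neg h')
  have hqrsupp : ∀ m ∈ qr.support, ¬ (m j = 0 ∧ (m.sum fun _ e => e) ≤ d) := fun m hm => by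
    rw [mem_support_iff, hqr, coeff_sum_filter_monomial] at hm
    intro h'; exact hm (if_neg (not_not.mpr h'))
  -- the residual form `R₁`
  set R₁ : MvPolynomial σ κ := dehomTransl κ j c Φ - q₁ ^ 2 with hR₁
  have hR₁eq : R₁ = (dehomTransl κ j c Φ - q ^ 2) + qr ^ 2 := by rw [hR₁, hsplit, add_pow_char]; ring
  have hdeg2 : ∀ m' : σ →₀ ℕ, ((2 • m').sum fun _ e => e) = 2 * m'.sum fun _ e => e := by
    intro m'
    rw [Finsupp.sum_smul_index' (fun _ => rfl)]
    simp [Finsupp.sum, Finset.mul_sum, smul_eq_mul]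
  have hR₁j : ∀ m ∈ R₁.support, m j = 0 := by
    intro m hm
    rcases Finset.mem_union.mp (support_sub σ _ _ hm) with h1 | h2
    · exact hφj m h1
    · obtain ⟨m', hm', rfl⟩ := exists_degree_eq_of_mem_support_sq q₁ h2
      simp [(hq₁supp m' hm').1]
  have hR₁deg : ∀ m ∈ R₁.support, (m.sum fun _ e => e) = 2 * d := by
    intro m hm
    apply le_antisymm
    · rcases Finset.mem_union.mp (support_sub σ _ _ hm) with h1 | h2
      · exact hφdeg m h1
      · obtain ⟨m', hm', rfl⟩ := exists_degree_eq_of_mem_support_sq q₁ h2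
        rw [hdeg2]; have := (hq₁supp m' hm').2; omega
    · have hmj := hR₁j m hm
      have hm' : m ∈ ((dehomTransl κ j c Φ - q ^ 2) + qr ^ 2).support := by rwa [← hR₁eq]
      rcases Finset.mem_union.mp (support_add hm') with h1 | h2
      · exact hq m h1
      · obtain ⟨m', hm'q, rfl⟩ := exists_degree_eq_of_mem_support_sq qr h2
        have hnot := hqrsupp m' hm'q
        have hm'j : m' j = 0 := by
          have : 2 * m' j = 0 := by simpa [two_nsmul, two_mul] using hmj
          omega
        rw [hdeg2]
        push Not at hnot
        have := hnot hm'j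
        omega
  have hR₁hom : R₁.IsHomogeneous (2 * d) := (isHomogeneous_iff_forall_mem_support R₁ _).mpr hR₁deg
  -- homogenise `q₁` to degree `d`
  set H : MvPolynomial σ κ :=
    ∑ m ∈ q₁.support, monomial (m + Finsupp.single j (d - m.sum fun _ e => e)) (coeff m q₁) with hH
  have hHhom : H.IsHomogeneous d := by
    rw [hH]
    refine IsHomogeneous.sum _ _ _ fun m hm => isHomogeneous_monomial _ ?_
    have hle := (hq₁supp m hm).2
    have hdeg : ∀ f : σ →₀ ℕ, Finsupp.degree f = f.sum fun _ e => e := fun f => rfl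
    rw [map_add, Finsupp.degree_single, hdeg]
    omega
  have hDH : dehomTransl κ j c H = dehomTransl κ j c q₁ := by
    conv_rhs => rw [q₁.as_sum]
    rw [hH, map_sum, map_sum]
    refine Finset.sum_congr rfl fun m _ => ?_
    unfold dehomTransl
    rw [aeval_monomial, aeval_monomial,
      Finsupp.prod_add_index' (h := fun i k => (if i = j then (1 : MvPolynomial σ κ) else X i + C (c i)) ^ k)
        (fun _ => pow_zero _) (fun _ _ _ => pow_add _ _ _),
      Finsupp.prod_single_index (h := fun i k => (if i = j then (1 : MvPolynomial σ κ) else X i + C (c i)) ^ k)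
        (pow_zero _), if_pos rfl, one_pow, mul_one]
  -- `Q := η_c H`; the two forms `Φ + Q²` and `η_c R₁` agree after dehomogenisation
  have hkey : Φ + (aeval (fun i => if i = j then X j else X i + C (c i) * X j) H) ^ 2 =
      aeval (fun i => if i = j then X j else X i + C (c i) * X j) R₁ := by
    apply eq_of_isHomogeneous_of_aeval_dehom_eq j (n := 2 * d)
    · refine hΦ.add ?_
      have := (isHomogeneous_aeval_eta j c hHhom).pow 2
      rwa [mul_comm] at this
    · exact isHomogeneous_aeval_eta j c hR₁hom
    · rw [map_add, map_pow, aeval_dehom_eta, hDH, aeval_dehom_eta, hR₁, map_sub, map_pow,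
        dehomTransl_dehomTransl, CharTwo.sub_eq_add]
  refine (mem_descentSpace_iff_exists_sq Φ c).mpr ⟨aeval (fun i => if i = j then X j else X i + C (c i) * X j) H, ?_⟩
  rw [hkey]
  exact isLineInvariant_aeval_eta hc R₁ hR₁j

/-- **L2c, literally as typed in the sketch** (`σ = Fin 4`). [folklore] -/
theorem mem_descentSpace_of_even_persistence_fin4 [CharP κ 2] [PerfectField κ] (d : ℕ) (j : Fin 4)
    (Φ : MvPolynomial (Fin 4) κ) (hΦ : Φ.IsHomogeneous (2 * d)) (c : Fin 4 → κ) (hc : c j = 1)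
    (h : SubTopIsSquare κ (2 * d) (dehomTransl κ j c Φ)) : c ∈ descentSpace κ Φ :=
  mem_descentSpace_of_even_persistence d j Φ hΦ c hc h

end Persistence

end Summit.ResolutionOfSingularities.ResolutionOfSingularities.Theorems.SwitchingDichotomy.DescentSpace

end
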